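import Literature.AlgebraicGeometry.ShimuraVarieties.UnitaryShimuraCurveHeckeHolds     -- ★ `RecordSystemGS.isLevelQuotient_holds` (u4)
import Literature.NumberTheory.Automorphic.Liu2021.AppendixC.RecordCurveSec42Datum       -- ★ `recordHeckeTranslateGS`
import Literature.AlgebraicGeometry.Motives.FiniteQuotientBaseChange                     -- ★ `isoFiniteQuotient_of_isSepQuotient`
import Literature.AlgebraicGeometry.RelativeSpec.GeometricQuotientRecognition            -- ★ `of_isoTarget`, `isGeometricQuotient_gluedMk`
import Literature.AlgebraicGeometry.Motives.IntegralModelReductionMap                    -- ★ `IntegralModel.genericIso'`, `genericFibre`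
import HarnessLib

/-!
# The level-quotient ACTION of `K ⁄ Kc` on the unitary Shimura curve `M⋆_{Kc}`: descent through `φ : K ↠ G`, the transition
# `M⋆_{Kc} → M⋆_K` as a GEOMETRIC quotient by `G`, and the generic-fibre compatibility square of an integral model

Topic `Literature/AlgebraicGeometry/ShimuraVarieties`; namespace `Literature.AlgebraicGeometry.ShimuraVarieties.UnitaryCanonicalModel`.
THEOREMS ONLY (no definition, no named fact, no instance, no notation, no `sorry`).  Cell `hodgecm-mathlib`, P6 «MOD programme»,
LEAD ruling M-1∕M-1a (4): the GENERIC-FIBRE HALF of hand M-Q = letter `F0D9opRoad2.RecordTameLevelQuotientModel` (the tame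
level-quotient packaging `𝒮 := 𝒮c ⁄ (K⁄Kc)` of a smooth proper model `𝒮c` of `M⋆_{Kc}`); the integral half (★
`Motives.IntegralModel.exists_quotient_of_isProper` + ★ `ActionOver.smoothOfRelativeDimension_one_and_isProper_gluedDesc_of_isUnit_card`)
and the head `quot_holds` are A-p14 (g30)'s sub-line `Cruxes/HLiu418/Lines/F0_P6q_TameLevelQuotient.lean`.  HC_CM is proved only modulo
the printed citations until rung 0 closes; nothing here is about HC.

THE MATHEMATICS ([Deligne1979ShimuraVarieties] 2.7.1 (b)–(c) «`(K⁄L)∖S_L ⥲ S_K`»; [Milne2005ShimuraVarieties] Rem. 5.29 (c) «`S_K` is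
the quotient of `S_{K′}` by `K⁄K′`»; [MumfordAV1970] §7 Thm. p. 66 (a finite-group quotient of a projective variety is a geometric
quotient)).  Let `S` be a record system of the unitary Shimura CURVE (`J⋆` hermitian non-degenerate), `Kc ≤ K` small levels with `Kc`
normalised by `K` (`hn : ∀ k ∈ K, k⁻¹ Kc k ⊆ Kc`, i.e. `C5.HeckeLE k Kc Kc`), and `φ : K ↠ G` a surjection onto a group `G` with
`ker φ = Kc`.  ★ (u4) `RecordSystemGS.isLevelQuotient_holds` gives `act : K → Aut_F(M⋆_{Kc})`, `act k = T_{k⁻¹}` (a Hecke translate by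
`k⁻¹`), with `M⋆_{Kc} → M⋆_K` the quotient of `M⋆_{Kc}` by the `act k` for separated test objects; `act` kills `Kc` (★
`IsLevelQuotient.act_eq_one_of_mem`), so it DESCENDS through `φ` to `σ : G →* Aut_F(M⋆_{Kc})` (Mathlib `MonoidHom.liftOfSurjective`);
`σ (φ k)` is THE record translate `recordHeckeTranslateGS S hU7ₛ k⁻¹ Kc Kc _` (uniqueness of translates ★ `heckeTranslate_unique`);
`M⋆_{Kc} → M⋆_K` is the separated quotient by `σ` and — `M⋆_{Kc}` being projective (record (F1)) — a GEOMETRIC quotient in Mumford's sense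
for the `RelativeSpec.ActionOver` attached to `σ` (★ `isoFiniteQuotient_of_isSepQuotient` + ★ `ActionOver.isGeometricQuotient_gluedMk` +
★ `IsGeometricQuotient.of_isoTarget`).  Finally, for an integral model `𝒮c` of `M⋆_{Kc}` over `𝒪_{F,(w)}` with an action `ρ` of `G`
whose generic fibre is the record translate (the letter's `_hρ`), the `hσ`-square consumed by ★ `IntegralModel.exists_quotient_of_isProper`
(`σ(g) ≫ genericIso⁻¹ ≫ pr₁ = genericIso⁻¹ ≫ pr₁ ≫ ρ(g)`) follows.

MAIN STATEMENTS.  §1 **`RecordSystemGS.exists_levelQuotientAction`** (`σ`, `σ (φ k)` is a translate by `k⁻¹`, `IsSepQuotient σ (M⋆_{Kc} → M⋆_K)`);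
§2 `RecordSystemGS.levelQuotientAction_hom_eq_recordHeckeTranslateGS`; §3 **`RecordSystemGS.isGeometricQuotient_of_isSepQuotient`** (any finite
`G →* Aut (S.M.obj Kc)` whose separated quotient is a transition) and **`RecordSystemGS.exists_levelQuotientAction_isGeometricQuotient`**
(the package (a)+(b)); §4 **`IntegralModel.hσ_of_genericFibre_square`** (the `hσ` binder of ★ `exists_quotient_of_isProper` from the
letter's `_hρ`) and the all-in-one **`RecordSystemGS.exists_levelQuotientAction_of_model`**.

## References
* [Deligne1979ShimuraVarieties] P. Deligne, *Variétés de Shimura: interprétation modulaire…*, Proc. Symp. Pure Math. 33 (1979), 2.7.1 (b)–(c), 2.1.4.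
* [Milne2005ShimuraVarieties] J. S. Milne, *Introduction to Shimura varieties* (2005), Rem. 5.29 (c) p. 65, Thm. 13.6 p. 118.
* [MumfordAV1970] D. Mumford, *Abelian Varieties* (1970), §7 Thm. p. 66 and Remark.
* [SGA1] A. Grothendieck, *SGA 1*, Exp. V Prop. 1.8, Prop. 1.9, Cor. 1.5.
-/

noncomputable section

-- `(ρ.aut g).hom` with `ρ.aut g : Aut _` is only type-correct after unfolding `Aut` (as in ★ `RelativeSpec/FiniteGroupQuotientGluing`,
-- ★ `Motives/IntegralModelOfFiniteQuotient`).
set_option backward.isDefEq.respectTransparency false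

open CategoryTheory CategoryTheory.Limits AlgebraicGeometry NumberField IsDedekindDomain
open scoped Matrix
open Literature.NumberTheory.Automorphic Literature.NumberTheory.Automorphic.UnitaryGroup
open Literature.NumberTheory.Automorphic.Liu2021.AppendixC
open Literature.AlgebraicGeometry.RelativeSpec (ActionOver)
open Literature.AlgebraicGeometry.Motives (IntegralModel SchemeOver IsSepQuotient)
open Literature.NumberTheory.EllipticCurves (genericFibre)

namespace Literature.AlgebraicGeometry.ShimuraVarieties.UnitaryCanonicalModel

variable {F : Type} [Field F] [NumberField F] [IsCMField F] {Jstar : Matrix (Fin 2) (Fin 2) F} {ι₁ : F →+* ℂ}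
  {K₀ : C5.OpenCompactSubgroup ↥(finAdelic ↥(maximalRealSubfield F) F (IsCMField.complexConj F) 2 Jstar)}

/-! ## §1 Descent of the level-quotient action through `φ : K ↠ G` -/

/-- **The level-quotient action of `G = K ⁄ Kc` on `M⋆_{Kc}`** ([Deligne1979ShimuraVarieties] 2.7.1 (b)–(c); ★ (u4)
`isLevelQuotient_holds`, descended through `φ` by ★ `IsLevelQuotient.act_eq_one_of_mem` and Mathlib `MonoidHom.liftOfSurjective`): for
`J⋆` hermitian and invertible, `Kc ≤ K` with `k⁻¹ Kc k ⊆ Kc` for `k ∈ K`, and `φ : K ↠ G` with `ker φ = Kc`, there is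
`σ : G →* Aut_F(M⋆_{Kc})` such that `σ (φ k)` is a Hecke translate by `k⁻¹` and `M⋆_{Kc} → M⋆_K` is the quotient of `M⋆_{Kc}` by the
`σ g` for separated test objects. [cite: Deligne1979ShimuraVarieties, 2.7.1 (b)–(c)] [cite: Milne2005ShimuraVarieties, Rem. 5.29 (c) p. 65] -/
theorem RecordSystemGS.exists_levelQuotientAction (S : RecordSystemGS F Jstar ι₁ K₀)
    (hJ : (Jstar.map (IsCMField.complexConj F))ᵀ = Jstar) (hJu : IsUnit Jstar)
    {Kc K : C5.SmallLevel K₀} (hKcK : Kc ≤ K) (hn : ∀ k ∈ K.1.1, C5.HeckeLE k Kc Kc)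
    (G : Type) [Group G] (φ : ↥K.1.1 →* G) (hφ : Function.Surjective φ)
    (hφker : φ.ker = (Kc.1.1 : Subgroup ↥(finAdelic ↥(maximalRealSubfield F) F (IsCMField.complexConj F) 2 Jstar)).subgroupOf K.1.1) :
    ∃ σ : G →* Aut (S.M.obj Kc),
      (∀ k : ↥K.1.1, S.IsHeckeTranslate Kc Kc
          ((k : ↥(finAdelic ↥(maximalRealSubfield F) F (IsCMField.complexConj F) 2 Jstar))⁻¹) (σ (φ k)).hom) ∧
        IsSepQuotient (fun g => σ g) (S.M.map (homOfLE hKcK)) := by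
  obtain ⟨act, hact, hq⟩ := S.isLevelQuotient_holds hJ ((Matrix.isUnit_iff_isUnit_det _).mp hJu) hKcK
    (fun k hk n hnn => hn k hk n hnn)
  -- `act` kills `ker φ = Kc`
  have hker : φ.ker ≤ act.ker := by
    intro k hk
    rw [hφker, Subgroup.mem_subgroupOf] at hk
    exact MonoidHom.mem_ker.mpr (RecordSystemGS.IsLevelQuotient.act_eq_one_of_mem hact k hk)
  let σ : G →* Aut (S.M.obj Kc) := φ.liftOfSurjective hφ ⟨act, hker⟩
  have hσ : ∀ k : ↥K.1.1, σ (φ k) = act k := fun k =>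
    φ.liftOfRightInverse_comp_apply (Function.surjInv hφ) (Function.rightInverse_surjInv hφ) ⟨act, hker⟩ k
  refine ⟨σ, fun k => by rw [hσ]; exact hact k, fun g => ?_, fun W f hW hf => ?_⟩
  · obtain ⟨k, rfl⟩ := hφ g
    change (σ (φ k)).hom ≫ _ = _
    rw [hσ]
    exact hq.hom_comp k
  · exact hq.existsUnique f hW fun k => by
      have e := hf (φ k)
      change (σ (φ k)).hom ≫ f = f at e
      rwa [hσ] at e

/-! ## §2 The descended automorphisms ARE the record translates -/

/-- **`σ (φ k) = T_{k⁻¹}` as the record's chosen translate** (uniqueness of Hecke translates, ★ `heckeTranslate_unique`, against ★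
`isHeckeTranslate_recordHeckeTranslateGS`). [cite: Milne2005ShimuraVarieties, Thm. 13.6 p. 118] [cite: Deligne1979ShimuraVarieties, 2.1.4] -/
theorem RecordSystemGS.hom_eq_recordHeckeTranslateGS_of_isHeckeTranslate (S : RecordSystemGS F Jstar ι₁ K₀)
    (hU7ₛ : S.HeckeTranslateDefinedOver) {Kc K : C5.SmallLevel K₀} (hn : ∀ k ∈ K.1.1, C5.HeckeLE k Kc Kc)
    (k : ↥K.1.1) {T : S.M.obj Kc ⟶ S.M.obj Kc}
    (hT : S.IsHeckeTranslate Kc Kc ((k : ↥(finAdelic ↥(maximalRealSubfield F) F (IsCMField.complexConj F) 2 Jstar))⁻¹) T) :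
    T = recordHeckeTranslateGS S hU7ₛ
      ((k : ↥(finAdelic ↥(maximalRealSubfield F) F (IsCMField.complexConj F) 2 Jstar))⁻¹) Kc Kc (hn _ (K.1.1.inv_mem k.2)) :=
  S.heckeTranslate_unique hT (isHeckeTranslate_recordHeckeTranslateGS S hU7ₛ _ Kc Kc _)

/-! ## §3 The transition `M⋆_{Kc} → M⋆_K` is a GEOMETRIC quotient by `G` -/

/-- **A separated quotient of `M⋆_{Kc}` by a finite group is a geometric quotient** ([MumfordAV1970] §7 Thm. p. 66: `M⋆_{Kc}` is
projective, record (F1), so the separated quotient `M⋆_{Kc} → M⋆_K` is Mumford's `M⋆_{Kc} ⁄ G` up to a unique isomorphism — ★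
`isoFiniteQuotient_of_isSepQuotient` — and `M⋆_{Kc} → M⋆_{Kc} ⁄ G` is a geometric quotient, ★ `isGeometricQuotient_gluedMk`, transported
along the isomorphism by ★ `of_isoTarget`).  Stated for the `RelativeSpec.ActionOver` attached to `σ` (the shape ★
`IntegralModel.exists_quotient_of_isProper` consumes). [cite: MumfordAV1970, §7 Thm. p. 66 (Remark)] [cite: SGA1, Exp. V Prop. 1.8] -/
theorem RecordSystemGS.isGeometricQuotient_of_isSepQuotient (S : RecordSystemGS F Jstar ι₁ K₀) {Kc K : C5.SmallLevel K₀}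
    {G : Type} [Group G] [Finite G] (σ : G →* Aut (S.M.obj Kc)) (p : S.M.obj Kc ⟶ S.M.obj K)
    (hq : IsSepQuotient (fun g => σ g) p) :
    (⟨((Over.forget _).mapAut (S.M.obj Kc)).comp σ, fun g => Over.w (σ g).hom⟩ :
        ActionOver (S.M.obj Kc).hom G).IsGeometricQuotient p.left := by
  have hY := S.projective Kc
  haveI : IsSeparated (S.M.obj Kc).hom := by haveI := hY.isProper; infer_instance
  have hZ : IsSeparated (S.M.obj K).hom := by haveI := (S.projective K).isProper; infer_instance
  let ρ : ActionOver (S.M.obj Kc).hom G := ⟨((Over.forget _).mapAut (S.M.obj Kc)).comp σ, fun g => Over.w (σ g).hom⟩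
  have hcov := ActionOver.forall_exists_stableAffineOpen_of_isProjectiveOver ρ hY
  obtain ⟨i, hi⟩ := Motives.isoFiniteQuotient_of_isSepQuotient hY σ p hZ hq
  -- the isomorphism of underlying schemes `M⋆_{Kc} ⁄ G ≅ M⋆_K`
  let e : (Motives.finiteQuotient ρ).left ≅ (S.M.obj K).left :=
    ⟨i.inv.left, i.hom.left, by rw [← Over.comp_left, i.inv_hom_id]; rfl, by rw [← Over.comp_left, i.hom_inv_id]; rfl⟩
  have hp' : p = Motives.finiteQuotient.mk ρ hcov ≫ i.inv := (Iso.eq_comp_inv i).mpr hi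
  have hp : p.left = ρ.gluedMk hcov ≫ e.hom := by
    rw [hp', Over.comp_left, Motives.finiteQuotient.mk_left]
  change ρ.IsGeometricQuotient p.left
  rw [hp]
  exact (ρ.isGeometricQuotient_gluedMk hcov).of_isoTarget e

/-- **The package (a)+(b) of hand M-Q's generic-fibre half**: `σ : G →* Aut_F(M⋆_{Kc})` with `σ (φ k) = T_{k⁻¹}` (the record's
chosen translate) and `M⋆_{Kc} → M⋆_K` a GEOMETRIC quotient by `G` for the attached `ActionOver`.
[cite: Deligne1979ShimuraVarieties, 2.7.1 (b)–(c)] [cite: MumfordAV1970, §7 Thm. p. 66] -/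
theorem RecordSystemGS.exists_levelQuotientAction_isGeometricQuotient (S : RecordSystemGS F Jstar ι₁ K₀)
    (hU7ₛ : S.HeckeTranslateDefinedOver) (hJ : (Jstar.map (IsCMField.complexConj F))ᵀ = Jstar) (hJu : IsUnit Jstar)
    {Kc K : C5.SmallLevel K₀} (hKcK : Kc ≤ K) (hn : ∀ k ∈ K.1.1, C5.HeckeLE k Kc Kc)
    (G : Type) [Group G] [Finite G] (φ : ↥K.1.1 →* G) (hφ : Function.Surjective φ)
    (hφker : φ.ker = (Kc.1.1 : Subgroup ↥(finAdelic ↥(maximalRealSubfield F) F (IsCMField.complexConj F) 2 Jstar)).subgroupOf K.1.1) :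
    ∃ σ : G →* Aut (S.M.obj Kc),
      (∀ k : ↥K.1.1, (σ (φ k)).hom = recordHeckeTranslateGS S hU7ₛ
          ((k : ↥(finAdelic ↥(maximalRealSubfield F) F (IsCMField.complexConj F) 2 Jstar))⁻¹) Kc Kc (hn _ (K.1.1.inv_mem k.2))) ∧
        IsSepQuotient (fun g => σ g) (S.M.map (homOfLE hKcK)) ∧
          (⟨((Over.forget _).mapAut (S.M.obj Kc)).comp σ, fun g => Over.w (σ g).hom⟩ :
              ActionOver (S.M.obj Kc).hom G).IsGeometricQuotient (S.M.map (homOfLE hKcK)).left := by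
  obtain ⟨σ, hσ, hq⟩ := S.exists_levelQuotientAction hJ hJu hKcK hn G φ hφ hφker
  exact ⟨σ, fun k => S.hom_eq_recordHeckeTranslateGS_of_isHeckeTranslate hU7ₛ hn k (hσ k), hq,
    S.isGeometricQuotient_of_isSepQuotient σ _ hq⟩

/-! ## §4 The `hσ`-square of ★ `IntegralModel.exists_quotient_of_isProper` from the letter's generic-fibre hypothesis `_hρ` -/

section Model

variable {R : Type} [CommRing R] [Algebra R F]

omit [NumberField F] [IsCMField F] in
/-- **From the letter's `_hρ` to the `hσ` binder of ★ `IntegralModel.exists_quotient_of_isProper`.**  Let `𝒳` be an integral model over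
`R` of an `F`-scheme `X`, `ρ` an action of `G` on `𝒳.total` over `Spec R`, `σ : G →* Aut X`, and suppose the generic fibre of `ρ g` is
`σ g` through `genericIso` (`(genericFibre R F).map (ρ g) ≫ genericIso = genericIso ≫ σ g`).  Then
`(σ g) ≫ genericIso⁻¹ ≫ pr₁ = (genericIso⁻¹ ≫ pr₁) ≫ ρ g` on underlying schemes. [cite: SGA1, Exp. V Prop. 1.9] -/
theorem IntegralModel.hσ_of_genericFibre_square {X : SchemeOver F} (𝒳 : IntegralModel R F X) {G : Type} [Group G]
    (ρ : ActionOver 𝒳.total.hom G) (σ : G →* Aut X)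
    (hρ : ∀ g : G, (genericFibre R F).map (Over.isoMk (ρ.aut g) (ρ.aut_comp g)).hom ≫ 𝒳.genericIso.hom =
      𝒳.genericIso.hom ≫ (σ g).hom) (g : G) :
    (σ g).hom.left ≫ 𝒳.genericIso.inv.left ≫ pullback.fst 𝒳.total.hom (Spec.map (CommRingCat.ofHom (algebraMap R F))) =
      (𝒳.genericIso.inv.left ≫ pullback.fst 𝒳.total.hom (Spec.map (CommRingCat.ofHom (algebraMap R F)))) ≫ (ρ.aut g).hom := by
  -- first projection of the base-changed automorphism
  have h3 : ((genericFibre R F).map (Over.isoMk (ρ.aut g) (ρ.aut_comp g)).hom).left ≫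
      pullback.fst 𝒳.total.hom (Spec.map (CommRingCat.ofHom (algebraMap R F))) =
      pullback.fst 𝒳.total.hom (Spec.map (CommRingCat.ofHom (algebraMap R F))) ≫ (ρ.aut g).hom :=
    pullback.lift_fst _ _ _
  -- `σ g ≫ genericIso⁻¹ = genericIso⁻¹ ≫ (ρ g)_F`
  have h1 : (σ g).hom ≫ 𝒳.genericIso.inv =
      𝒳.genericIso.inv ≫ (genericFibre R F).map (Over.isoMk (ρ.aut g) (ρ.aut_comp g)).hom := by
    rw [Iso.comp_inv_eq, Category.assoc, Iso.eq_inv_comp]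
    exact (hρ g).symm
  have h2 : (σ g).hom.left ≫ 𝒳.genericIso.inv.left =
      𝒳.genericIso.inv.left ≫ ((genericFibre R F).map (Over.isoMk (ρ.aut g) (ρ.aut_comp g)).hom).left := by
    rw [← Over.comp_left, h1, Over.comp_left]
  rw [← Category.assoc, h2, Category.assoc, h3, Category.assoc]

end Model

/-- **Hand M-Q, generic-fibre half, ALL IN ONE** (what the integral half consumes BY NAME): from the letter's data
`(S, hU7ₛ, hJ, hJu, Kc ≤ K, hn, G, φ, hφ, hφker, 𝒮c, ρ, _hρ)` — an integral model `𝒮c` of `M⋆_{Kc}` over `𝒪_{F,(w)}` with a `G`-action `ρ`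
whose generic fibre is `k ↦ T_{k⁻¹}` — there is `σ : G →* Aut_F(M⋆_{Kc})` with (i) the `hσ`-square of ★ `IntegralModel.exists_quotient_of_isProper`
for `(𝒮c, ρ, σ)`, (ii) `M⋆_{Kc} → M⋆_K` a GEOMETRIC quotient by `G` for the action attached to `σ` (its `hq`), and (iii) `σ (φ k) = T_{k⁻¹}`.
[cite: Deligne1979ShimuraVarieties, 2.7.1 (b)–(c)] [cite: MumfordAV1970, §7 Thm. p. 66] [cite: SGA1, Exp. V Prop. 1.9] -/
theorem RecordSystemGS.exists_levelQuotientAction_of_model (S : RecordSystemGS F Jstar ι₁ K₀)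
    (hU7ₛ : S.HeckeTranslateDefinedOver) (hJ : (Jstar.map (IsCMField.complexConj F))ᵀ = Jstar) (hJu : IsUnit Jstar)
    {Kc K : C5.SmallLevel K₀} (hKcK : Kc ≤ K) (hn : ∀ k ∈ K.1.1, C5.HeckeLE k Kc Kc)
    (G : Type) [Group G] [Finite G] (φ : ↥K.1.1 →* G) (hφ : Function.Surjective φ)
    (hφker : φ.ker = (Kc.1.1 : Subgroup ↥(finAdelic ↥(maximalRealSubfield F) F (IsCMField.complexConj F) 2 Jstar)).subgroupOf K.1.1)
    (w : HeightOneSpectrum (𝓞 F))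
    (𝒮c : IntegralModel (HeightOneSpectrum.valuationSubringAtPrime F w) F (S.M.obj Kc))
    (ρ : ActionOver 𝒮c.total.hom G)
    (hρ : ∀ k : ↥K.1.1,
       (genericFibre (HeightOneSpectrum.valuationSubringAtPrime F w) F).map (Over.isoMk (ρ.aut (φ k)) (ρ.aut_comp (φ k))).hom
           ≫ 𝒮c.genericIso'.hom
         = 𝒮c.genericIso'.hom ≫
             recordHeckeTranslateGS S hU7ₛ
               ((k : ↥(finAdelic ↥(maximalRealSubfield F) F (IsCMField.complexConj F) 2 Jstar))⁻¹) Kc Kc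
               (hn _ (K.1.1.inv_mem k.2))) :
    ∃ σ : G →* Aut (S.M.obj Kc),
      (∀ g : G, (σ g).hom.left ≫ 𝒮c.genericIso.inv.left ≫
          pullback.fst 𝒮c.total.hom (Spec.map (CommRingCat.ofHom
            (algebraMap (HeightOneSpectrum.valuationSubringAtPrime F w) F))) =
        (𝒮c.genericIso.inv.left ≫ pullback.fst 𝒮c.total.hom (Spec.map (CommRingCat.ofHom
            (algebraMap (HeightOneSpectrum.valuationSubringAtPrime F w) F)))) ≫ (ρ.aut g).hom) ∧
      (⟨((Over.forget _).mapAut (S.M.obj Kc)).comp σ, fun g => Over.w (σ g).hom⟩ :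
          ActionOver (S.M.obj Kc).hom G).IsGeometricQuotient (S.M.map (homOfLE hKcK)).left ∧
      (∀ k : ↥K.1.1, (σ (φ k)).hom = recordHeckeTranslateGS S hU7ₛ
          ((k : ↥(finAdelic ↥(maximalRealSubfield F) F (IsCMField.complexConj F) 2 Jstar))⁻¹) Kc Kc (hn _ (K.1.1.inv_mem k.2))) := by
  obtain ⟨σ, hσT, -, hgq⟩ := S.exists_levelQuotientAction_isGeometricQuotient hU7ₛ hJ hJu hKcK hn G φ hφ hφker
  refine ⟨σ, fun g => ?_, hgq, hσT⟩
  refine IntegralModel.hσ_of_genericFibre_square 𝒮c ρ σ (fun g => ?_) g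
  obtain ⟨k, rfl⟩ := hφ g
  rw [hσT k]
  exact hρ k

end Literature.AlgebraicGeometry.ShimuraVarieties.UnitaryCanonicalModel
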